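import Summits.AtomisticToContinuum.BoseEinsteinCondensation.Theses.BECSubharmonicContinuation
import Summits.AtomisticToContinuum.BoseEinsteinCondensation.Theorems.BECPeriodicReductionBoundaryTransferWeakResidual

/-!
# BC2 probes for the RESTATED re-audit of `BoundaryTransferWeak` (stmt-AtomisticToContinuum-0827)

crux-strategist planner-cstrat-stmt-AtomisticToContinuum-0827-r1-0, 2026-08-17.
`X` = `BECSubharmonicContinuation.BoundaryTransferWeak`, `S` = `_root_.BoseEinsteinCondensation`.
These examples document (i) the logical position of `X` (S ⟹ X trivially), and (ii) that the two
one-piece reductions already LANDED on 0827 (p96138) make their open piece fail criterion (c)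
("the probe `Xᵢ → X` must FAIL"): it closes by `exact`.
-/

open Literature.MathematicalPhysics.QuantumManyBody.BoseGas
open Summit.AtomisticToContinuum.BoseEinsteinCondensation

namespace Summit.AtomisticToContinuum.BoseEinsteinCondensation.Cruxes.BoundaryTransferWeak.Probes

/-- `S → X` is trivial: `X`'s conclusion is `S`'s body (the crux is logically WEAKER than the
Statement; it is RESTATED only in the structural sense that it concludes the Statement's body). -/
example : _root_.BoseEinsteinCondensation →
    Theses.BECSubharmonicContinuation.BoundaryTransferWeak :=
  fun h v hv _ => h v hv

/-- The shared item is one decl up to δ-unfolding: the `BECPeriodicReduction` copy (target of the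
landed p96138 theorems) and this route's copy are definitionally equal. -/
example : Theses.BECPeriodicReduction.BoundaryTransferWeak ↔
    Theses.BECSubharmonicContinuation.BoundaryTransferWeak :=
  Iff.rfl

/-- Candidate piece `Unrewarding` (the λ → 0⁺ interchange = LSSY App. D open converse, typed):
`Unrewarding → X` is LANDED (`boundaryTransferWeak_of_unrewarding`), so as a piece of a split it
violates (c) — the probe closes by `exact`. -/
example : RewardPaysTheWall.Unrewarding →
    Theses.BECSubharmonicContinuation.BoundaryTransferWeak :=
  fun h => RewardPaysTheWall.boundaryTransferWeak_of_unrewarding h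

/-- Candidate piece "condensed competitors suffice" (`CondensedToBEC`, reward-free residual):
`CondensedToBEC → X` is LANDED (`boundaryTransferWeak_of_condensedToBEC`) — violates (c). -/
example :
    (∀ v : ℝ → ENNReal, IsRepulsiveFiniteRange v → ∃ ρ₄ : ℝ, 0 < ρ₄ ∧ ∀ ρ : ℝ, 0 < ρ → ρ < ρ₄ →
      ∀ c : ℝ, 0 < c → c ≤ 1 →
        (∀ θ : ℝ, 0 < θ → ∀ᶠ N : ℕ in Filter.atTop, ∃ Ψ : TrialState N (sideLength ρ N),
          energy v Ψ ≤ groundStateEnergy v N (sideLength ρ N) + ENNReal.ofReal (θ * N) ∧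
            ENNReal.ofReal ((c - θ) * N) ≤ occupation N (boxConstantMode (sideLength ρ N)) Ψ.ψ) →
        HasGroundStateBEC v ρ) →
    Theses.BECSubharmonicContinuation.BoundaryTransferWeak :=
  fun h => RewardPaysTheWall.boundaryTransferWeak_of_condensedToBEC h

/-- Candidate piece `UpperBoundToBEC` (rewarded residual): landed one-liner — violates (c). -/
example :
    (∀ v : ℝ → ENNReal, IsRepulsiveFiniteRange v → ∃ ρ₄ : ℝ, 0 < ρ₄ ∧ ∀ ρ : ℝ, 0 < ρ → ρ < ρ₄ →
      ∀ c : ℝ, 0 < c → c ≤ 1 → RewardPaysTheWall.RewardedUpperBound v ρ c → HasGroundStateBEC v ρ) →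
    Theses.BECSubharmonicContinuation.BoundaryTransferWeak :=
  fun h => RewardPaysTheWall.boundaryTransferWeak_of_upperBoundToBEC h

/-- The A-consuming half of the transfer is fully cashed: torus BEC at `(v, ρ, c)` gives the
rewarded upper bound (landed `stub_transfer`, p85115). Hence every split of `X` along the
competitor seam has exactly ONE open piece. -/
example (v : ℝ → ENNReal) (hv : IsRepulsiveFiniteRange v) :
    ∃ ρ₁ : ℝ, 0 < ρ₁ ∧ ∀ ρ : ℝ, 0 < ρ → ρ < ρ₁ → ∀ c : ℝ, 0 < c →
      RewardPaysTheWall.TorusBECAt v ρ c → RewardPaysTheWall.RewardedUpperBound v ρ (min c 1) :=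
  RewardPaysTheWall.stub_transfer v hv

end Summit.AtomisticToContinuum.BoseEinsteinCondensation.Cruxes.BoundaryTransferWeak.Probes
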